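import Summits.AtomisticToContinuum.Crystallization.Theorems.ChargedEnergyGapFrozenMomentA
import HarnessLib

/-!
# ChargedEnergyGap · NODE 81 «FrozenMoment» (lens-3 g80) — ONE certified translation (the seven-point depth dictionary) + split beneath NODE 79's leaf (M°)′

Line of record: `stmt-AtomisticToContinuum-14231` (`Summit.AtomisticToContinuum.ChargedEnergyGap`); target = NODE 79's residual-deciding leaf,
VERBATIM (convex-pieces edition, tree `…ChargedEnergyGapBallMatchingConvex`)

  (M°)′ `BallMatchingQ' cls₀ 80 20 130 106 (1/3600000000) (1/60000000) (1/2000000) (3/5) (1/3) 3 (3/100) 160 80 (6/5) (3/2) (679/1000) (691/1000)`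

(for every heavy active CREASED ordered mid pair `(y, z)`: `0 < Π(y)` and `Ξ(y) ≤ Π(y)²`, ball pool `Π`, ball moment `Ξ = Σ_x pool·ballLoad`).

THE OBSERVATION (g80).  For a χ-free octahedron the cost `frameVal` is ALREADY a function of the six vertex depths alone (crease frame:
`W∘vertices = φ∘depth`); the content of (M°)′ is the integral geometry of the distance function `d = dist(·, C)` sampled on the reference
octahedra near the medial axis of the void.  Writing the six depths as axial means/differences, planar patterns are exactly `m₁ = m₂ = m₃ = d(c)`
(`c` the centre = the octahedral hole) and the cost is driven by the AXIAL KINKS `J_a := (2d(c) − d(c+ρf_a) − d(c−ρf_a))/ρ ∈ [0, 2]` — the second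
differences of `d` along the three lattice axis lines through the hole (site–hole–site, spacing `ρ`).  Measured (any-feet LP, `T75`, `rbox 4.5 %`):
the cost is a THRESHOLD-CONVEX function of `J := max_a J_a` at fixed depth — at min-depth `118.6`: `J = 2 ↦ 46.6 c_T` (flat fold through the hole,
tilt `5°`), `1.5 ↦ 17`, `1.0 ↦ 3`, `≤ 0.4 ↦ ≤ 0.5 c_T` (weak creases are absorbed by the zero cone) — and multi-axis kinks (cone apices, junction cores:
two axes at `J ≈ 1.9`) cost NO MORE than the single fold of the same `J` (`29` vs `46`).  Along every line the kinks obey a BUDGET (semiconcavity of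
`d² − |x|²`: the slope of `d` rises by at most `h/d` per step `h`, so the ridge slope-drops on a segment of length `ℓ` at depth `≥ d₀` total
`≤ 2 + ℓ/d₀`; typed and PROVED below as the discrete `kinkBudget`) — the door of the new residual.

THE ONE TRANSLATION (EQUIV, PROVED) = THE SEVEN-POINT DEPTH DICTIONARY `sevenPoint_dictionary` / `octMinDepth_eq_setMinDepth` /
`octMaxKink_eq_setMaxKink`: for an anchored frame `(c, f, ρ)` of a χ-free clean non-plateau octahedron with feet `q_u` (tree `crease_frame`) and a
nearest point `q₀` of the CENTRE, the seven-point set `S = {q₀, q_u}` reproduces EXACTLY the six vertex depths and the centre depth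
(`infDist v S = infDist v C`), hence the frame-free descriptors — MIN-DEPTH `octMinDepth = sInf` of the site depths and MAX-KINK `octMaxKink = sSup` of
`(2 d(½(y+z)) − d(x) − d(y+z−x))/(dist y z/2)` over the sites — EQUAL the finite-dimensional ones of the frame (`setMinDepth`, `setMaxKink` of
`(c, f, ρ, S)`).  Thus the cost of every χ-free creased octahedron is capped by a function of TWO numbers read off `C` through `≤ 7` points.

SPLIT BENEATH (M°)′ — (M°)′ ⟸ (KC) ∧ (M_F) (glue `ballMatchingQ'_of_frozen`, PROVED: termwise domination `Ξ ≤ Ξ_F`, finiteness of the pair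
supports from the separation):

  (KC)  `KinkCostTableQ ρlo ρhi ϱ τ unit` — THE KINK–COST TABLE (finite-dimensional, any seven-point set): for `ρ` in the window, every orthonormal
        frame and every nonempty `S ⊂ E3` of `≤ 7` points, `(τ·2ρ)²·roofVal T75 (φ ∘ infDist(v_u, S)) ≤ unit · capK(setMinDepth, setMaxKink)`,
        `capK` = the 75 × 13 table `capKRows` (min-depth rows: `< 93.5`, `0.5`-rows on `[93.5, 130)`, `[130, 140)`; `0` from `140`; kink columns
        `J < ½`, `[½, 1)`, `0.1`-columns on `[1, 2)`, `≥ 2`), entries = `⌈1.03 × (observed cell-and-neighbours maximum) + 0.1⌉_{0.1}` in units of `c_T`.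
        Census `num/zcap.py`, `zfold.py` (g80): `3.5·10⁵` LP evaluations — random structured seven-point sets (folds, tilted/asymmetric folds,
        3–4-sheet junction apices, cones, spheres, random) over min-depth `84–146`, PLUS deterministic sweeps of two-feet folds (normals `(001)`, `(110)`,
        `(111)`, `(210)`, `(211)`, `(311)`, `(321)`, near-axis; tilt `0–60°`; phase `ρ/8`-grid; depth `0.25`/`0.1`-grid near the peak; `ρ ∈ {0.679, 0.685,
        0.6868, 0.691}`): envelope = the near-axis fold through the hole (`46.6 c_T` at min-depth `118.6`, `J = 1.99`, tilt `5°`, `ρ = 0.691`); table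
        maximum `48.1`; `0` violations of `capK ≥ observed`.  [TABLE · NEW · TRUE-leaning (sampled) · FINITE (≤ 26 real parameters, compact box) ·
        INSTRUMENTABLE · ATTACKABLE-M: cell decomposition + one LP dual certificate with slack per cell + Lipschitz bounds of `φ ∘ infDist`; door
        [CELL-LP], the technology of (Z₀)/(S♯)/(Z_K)]
  (M_F) `FrozenMatchingQ' cls₀ 80 20 130 106 (1/3600000000) (1/60000000) (1/2000000) (1/60000000) (3/5) (1/3) 3 (3/100) 160 80 (6/5) (3/2) (679/1000)
        (691/1000)` — THE FROZEN MATCHING: for every heavy active creased `(y, z)`: `0 < Π(y)` and `Ξ_F(y) ≤ Π(y)²`, where the FROZEN MOMENT `Ξ_F`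
        is `Ξ` with the sixth-cost of every χ-FREE heavy active pair replaced by `capVal/6 = unit·capK(octMinDepth, octMaxKink)/6` — a function of the
        min-depth and the max-kink of ITS OWN octahedron only (χ-touching heavy pairs keep their raw `frameVal/6`).  Census `num/zfrozen.py` (g80; the
        g76 `slabcut` ledger with class-K costs replaced by `capK`, 8 comb phases, `L ∈ [114, 124]`, χ-cut distance `c ∈ [76, 84]`): worst frozen ratio
        `0.967` at `(L, c) = (118, 80.7)`, phase `0` (true ratio `0.859`; `K_F/K = 1.13` = ρ-window `4.5 %` + tilt envelope `1.7 %` + cell mixing `3 %`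
        + safety `3.5 %`), `0.960 @ 117`, `0.952 @ 118.5`, `0.921 @ 119`, `≤ 0.86` from `120`; X-dominated cuts (`c ≤ 80.3`) untouched (`≤ 0.858`).
        Point/line maxima of `d` (sphere/cylinder voids, junction lines) are over-capped (`cap/true ≤ 1.6`) on sets of dimension `≤ 1` — negligible
        against ball budgets `∝ R_N²`.  [RESIDUAL-DECIDING · NEW as typed · TRUE-leaning, THIN (margin `1.034` on the binding slab family vs `1.165` for
        (M°)′) · LOCAL · INSTRUMENTABLE · ATTACKABLE-L; door [KINK-BUDGET]: per axis line through the ball the kinks of the capped octahedra total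
        `≤ 2 + 160/d₀ ≈ 3.4` (`kinkBudget`), the table is threshold-convex in `J`, so per line at most `≈ 1.15` flat-fold equivalents are charged; the
        budget side is the pool profile of ONE sheet (between two strong sheets the slope of `d` must recover: `ℓ ≥ 2d ≈ 240 > 2R_N`)]

Support, PROVED here: the dictionary lemmas, the BRIDGE `frameVal_le_capVal` ((KC) ⟹ `frameVal ≤ capVal` on χ-free clean non-plateau shell pairs of
a framed reference, via tree `crease_frame` + `frameVal_le_of_mem`), the dominations `ballLoad_le_frozenLoad`, `ballMoment_le_frozenMoment`, the
glue, the designate `ballMatchingQ'_designate_of_frozen` and the q-designate cone `chargedEnergyGap_of_frozenMoment_numerics` (NODE 79's cone with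
(M°)′ replaced by (KC) ∧ (M_F)); and the door lemma `kinkBudget` (discrete semiconcavity of the distance function along a line: PROVED, pure metric
geometry).  Jointly (KC) ∧ (M_F) are STRONGER than (M°)′ (capped costs dominate true costs).

Dead ends recorded (g80 NOTES/MEMO): a cap by min-depth alone is kink-blind (colonnade voids: coverage `≈ 0.2`); a cap by (min-depth, feet
diameter) double-counts the comb phases (phase `h/2`: two creased hole planes capped `44` each vs true `0.8`: coverage `0.55`); a class-share split
of the budget is infeasible (`θ_K ≥ 0.86 @ c = 80.7` vs `θ_X ≥ 0.73 @ c = 78`); the exact any-feet supremum as cap is a costume of (M°)′.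

FILE B of three: file A `…ChargedEnergyGapFrozenMomentA` = the table `capK`, the descriptors, the leaf (KC) and the dictionary (§1–§3); THIS file =
the bridge (§4), the frozen load / moment and the leaf (M_F) (§5), the glue (§6); `…ChargedEnergyGapFrozenMoment` = the door lemma `kinkBudget` (§7),
the designate and the cone (§8).  Imports ONLY `…ChargedEnergyGapFrozenMomentA` (hence the tree file `…ChargedEnergyGapBallMatchingConvex` of
NODE 79: `ballPool`, `ballMoment`, `BallSupportQ`, `BallMatchingQ'`, the cone; `…PoolBallsConvex`, `…PoolCells`, `…BeamCells`, `…RoofCover`) and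
`HarnessLib`; no `set_option`, no `sorry`, no instance, no notation, no `private`.  Same namespace; new declaration names `capKRows`, `capKRow`,
`capKCol`, `capK`, `setDepth`, `setMinDepth`, `setKink`, `setMaxKink`, `KinkCostTableQ`, `octCentre`, `octKink`, `octMinDepth`, `octMaxKink`,
`capVal` (file A), `frozenCost`, `frozenLoad`, `frozenMoment`, `FrozenMatchingQ'` (this file) (+ lemmas prefixed `fz_`/named above; no clash in the
tree namespace, checked by `rg`).
-/

noncomputable section

open scoped Classical
open Literature.MathematicalPhysics.StatisticalMechanics Literature.Geometry.DiscreteGeometry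
open Summit.AtomisticToContinuum.Crystallization.Theses.PricedLinkCensus
open Summit.AtomisticToContinuum.Crystallization.Theorems.ChargedEnergyGapNegative

namespace Summit.AtomisticToContinuum.Crystallization.Theorems.ChargedEnergyGapChartDial

/-! ## §4 The bridge: (KC) ⟹ `frameVal ≤ capVal` on χ-free clean non-plateau shell pairs (PROVED) -/

section Bridge

variable {ϱχ : ℝ} {m : ℕ} {D : Fin m → Set E3} {σ : Fin m → Bool}

/-- ★★★ **THE BRIDGE (PROVED)**: under (KC), the cost of a χ-free clean non-plateau shell octahedron of a framed reference is at most its cap value —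
crease frame (tree `crease_frame`), a nearest point of the centre as seventh foot, the seven-point dictionary, the two translations, and
`frameVal_le_of_mem`. -/
theorem frameVal_le_capVal {unit ϱ τ r₁ r₂ ρlo ρhi : ℝ} {P : PeriodicConfiguration 3} {C X : Set E3} {y z : E3}
    (hu : 0 ≤ unit) (hϱ : 0 < ϱ) (hϱχ : 0 < ϱχ) (hr₁ : 0 ≤ r₁) (hsmall : 2 * (r₁ + r₂) < ϱχ / 2) (hlo : 0 < ρlo)
    (hK : KinkCostTableQ ρlo ρhi ϱ τ unit) (hFr : IsFramedOct P r₁ r₂ ρlo ρhi)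
    (hy : y ∈ P.points) (hz : z ∈ P.points) (hd1 : r₁ < dist y z) (hd2 : dist y z ≤ r₂) (hclean : OctClean P r₁ X y z)
    (hplat : ¬OctPlateau P r₁ (siteW ϱχ D σ X ϱ C) y z) (hcf : OctChiFree ϱχ D P r₁ y z) :
    frameVal (roofVal T75) τ (siteW ϱχ D σ X ϱ C) P r₁ y z ≤ capVal unit C P r₁ y z := by
  obtain ⟨c, f, ρ, q, hf, hρ, hρ1, hρ2, hyv, hzv, hO, hq, -, hfd, -, -, hfun⟩ :=
    crease_frame (σ := σ) (X := X) hϱ hϱχ hr₁ hsmall hlo hFr hy hz hd1 hd2 hclean hplat hcf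
  -- `C` is nonempty: the feet lie in its closure
  have hneC : C.Nonempty := closure_nonempty_iff.1 ⟨q (0, false), (hq _).1⟩
  -- the seventh foot: a nearest point of the centre
  obtain ⟨q₀, hq₀, hq₀d⟩ := Metric.exists_mem_closure_infDist_eq_dist hneC c
  set S : Finset E3 := insert q₀ (Finset.univ.image q) with hS
  have hSne : S.Nonempty := Finset.insert_nonempty _ _
  have hScard : S.card ≤ 7 := by
    refine (Finset.card_insert_le _ _).trans ?_
    have h6 : (Finset.univ.image q).card ≤ 6 := by
      refine Finset.card_image_le.trans ?_
      rw [Finset.card_univ, Fintype.card_prod, Fintype.card_fin, Fintype.card_bool]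
    omega
  obtain ⟨hdep, hcen⟩ := sevenPoint_dictionary hq hq₀ hq₀d
  -- the table at the seven-point set
  have hKS := hK ρ hρ1 hρ2 c f hf S hSne hScard
  -- the pattern of `S` is the configuration pattern
  have hpat : (fun u : Fin 3 × Bool => depthProfile ϱ (setDepth c f ρ ↑S u)) =
      fun p : Fin 3 × Bool => siteW ϱχ D σ X ϱ C (octVertex c f ρ p.1 p.2) := by
    rw [hfun]
    funext u
    rw [hdep u, ← hfd u]
  -- the descriptors of `S` are the frame-free ones
  have hmin : setMinDepth c f ρ ↑S = octMinDepth C P r₁ y z := by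
    rw [octMinDepth_eq_setMinDepth C hO]
    unfold setMinDepth
    congr 1
    funext u
    rw [hdep u]
    rfl
  have hmax : setMaxKink c f ρ ↑S = octMaxKink C P r₁ y z := by
    rw [octMaxKink_eq_setMaxKink C hf hρ hyv hzv hO]
    unfold setMaxKink
    congr 1
    funext u
    unfold setKink
    rw [hdep u, hdep (u.1, !u.2), hcen]
    rfl
  rw [hpat, hmin, hmax] at hKS
  have hmem : (τ * (2 * ρ)) ^ 2 * roofVal T75 (fun p : Fin 3 × Bool => siteW ϱχ D σ X ϱ C (octVertex c f ρ p.1 p.2)) ∈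
      frameValSet (roofVal T75) τ (siteW ϱχ D σ X ϱ C) P r₁ y z :=
    ⟨c, f, ρ, hf, hρ, hyv, hzv, hO, rfl⟩
  exact frameVal_le_of_mem hmem hKS (capVal_nonneg hu C P r₁ y z)

end Bridge

/-! ## §5 The frozen load, the frozen moment and the residual leaf (M_F) -/

section Frozen

variable (ϱχ : ℝ) {m : ℕ} (D : Fin m → Set E3) (σ : Fin m → Bool)

/-- ★ The FROZEN COST of the ordered mid pair `(y, z)`: its cap value if its octahedron is χ-free, else its raw cost `frameVal`. -/
def frozenCost (unit : ℝ) (P : PeriodicConfiguration 3) (C X : Set E3) (τ ϱ r₁ : ℝ) (y z : E3) : ℝ :=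
  if OctChiFree ϱχ D P r₁ y z then capVal unit C P r₁ y z else frameVal (roofVal T75) τ (siteW ϱχ D σ X ϱ C) P r₁ y z

/-- ★ The **FROZEN LOAD** at `x`: `ballLoad` with the sixth-cost of every heavy active pair replaced by its frozen sixth-cost. -/
def frozenLoad (R_N unit r_f dK dstar κ c_T cχ : ℝ) (P : PeriodicConfiguration 3) (C X : Set E3) (τ ϱ r₁ r₂ : ℝ) (x : E3) : ℝ :=
  ∑ᶠ p : E3 × E3,
    if HeavyActive ϱχ D σ r_f dK dstar κ c_T cχ P C X τ ϱ r₁ r₂ p.1 p.2 ∧ dist x p.1 ≤ R_N then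
      (1 / 6) * frozenCost ϱχ D σ unit P C X τ ϱ r₁ p.1 p.2
    else 0

/-- ★ The **FROZEN MOMENT** `Ξ_F(y)`: the pool-weighted frozen loads of the reference sites within `R_N` of `y`. -/
def frozenMoment (R_N unit r_f dK dstar κ c_T cχ : ℝ) (P : PeriodicConfiguration 3) (C X : Set E3) (τ ϱ r₁ r₂ : ℝ) (y : E3) : ℝ :=
  ∑ᶠ x : E3, if x ∈ P.points ∧ dist x y ≤ R_N then
    pool ϱχ D σ r_f dK dstar κ c_T cχ P C X τ ϱ r₁ r₂ x * frozenLoad ϱχ D σ R_N unit r_f dK dstar κ c_T cχ P C X τ ϱ r₁ r₂ x else 0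

variable {ϱχ D σ}

/-- ★★★ **(M_F) THE FROZEN MATCHING** — per octahedron, LOCAL, costs of χ-free pairs FROZEN to their (min-depth, max-kink) caps: for a HEAVY ACTIVE
CREASED ordered mid pair `(y, z)` the ball pool is positive and the frozen moment is at most the squared ball pool, `0 < Π(y)` and
`Ξ_F(y) = Σ_{x ∈ ball(y)} pool(x)·frozenLoad(x) ≤ Π(y)²` — a statement about the distance function `d = dist(·, C)` on the reference near `y` (the
caps of the χ-free pairs see only `(min-depth, max-kink)` of their own octahedron; χ-touching heavy pairs keep `frameVal/6`).
[RESIDUAL-DECIDING · NEW as typed · TRUE-leaning, THIN: g80 census `num/zfrozen.py` (slabcut ledger, class-K costs ↦ `capK`, 8 comb phases,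
`L ∈ [114, 124]`, `c ∈ [76, 84]`): worst frozen ratio `0.967` at `(L, c) = (118, 80.7)` phase `0` (true `0.859`), i.e. margin `1.034` (vs `1.165`);
sphere / cylinder / junction lines over-capped only on sets of dimension `≤ 1` · LOCAL · INSTRUMENTABLE · ATTACKABLE-L; door [KINK-BUDGET]: along
every axis line the kinks of the capped octahedra total `≤ 2 + ℓ/d₀` (`kinkBudget`, PROVED below), `capK` is threshold-convex in `J`, the pool
budget of a ball is the profile of ONE strong sheet (`ℓ ≥ 2d > 2R_N` between two) — why it might fail: a void whose medial sheet near depth `118` is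
decorated by secondary ridges of kink `J ∈ [1.3, 1.6]` within `R_N` (charged `15–25 c_T` each by the table) while the pool stays that of one slab;
the `3.4 %` margin does not absorb a second half-strength sheet] -/
def FrozenMatchingQ' (cls : Set E3 → Prop) (R_N r_f dK dstar κ c_T cχ unit : ℝ) (s lam ℓ τ ϱ ϱχ r₁ r₂ ρlo ρhi : ℝ) : Prop :=
  ∀ (P : PeriodicConfiguration 3) (C X : Set E3) (m : ℕ) (D : Fin m → Set E3) (σ : Fin m → Bool),
    IsSeparatedRef s P → IsLabelledRef lam ℓ P → cls P.points → IsForceFree P → IsSiteStressFree P →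
    IsInvariantSet P C → IsInvariantSet P X → (∀ i, IsInvariantSet P (D i)) → (∀ i, IsConvexPieces (2 * ϱχ) (D i)) →
    IsFramedOct P r₁ r₂ ρlo ρhi →
    ∀ y z : E3, HeavyActive ϱχ D σ r_f dK dstar κ c_T cχ P C X τ ϱ r₁ r₂ y z → ¬OctTame r_f C P r₁ y z →
      0 < ballPool ϱχ D σ R_N r_f dK dstar κ c_T cχ P C X τ ϱ r₁ r₂ y ∧
        frozenMoment ϱχ D σ R_N unit r_f dK dstar κ c_T cχ P C X τ ϱ r₁ r₂ y ≤
          ballPool ϱχ D σ R_N r_f dK dstar κ c_T cχ P C X τ ϱ r₁ r₂ y ^ 2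

end Frozen

/-! ## §6 The glue: (KC) ∧ (M_F) ⟹ (M°)′ (PROVED: termwise domination on finite supports) -/

section Glue

variable {ϱχ : ℝ} {m : ℕ} {D : Fin m → Set E3} {σ : Fin m → Bool}

/-- A finsum comparison on a common finite superset of the supports. [formal bookkeeping] -/
theorem fz_finsum_le {α : Type*} {f g : α → ℝ} (S : Finset α) (hf : Function.support f ⊆ ↑S) (hg : Function.support g ⊆ ↑S)
    (h : ∀ a ∈ S, f a ≤ g a) : ∑ᶠ a, f a ≤ ∑ᶠ a, g a := by
  rw [finsum_eq_sum_of_support_subset _ hf, finsum_eq_sum_of_support_subset _ hg]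
  exact Finset.sum_le_sum h

/-- The pairs `(y', z')` entering a ball load at `x` — heavy active with `dist x y' ≤ R_N` — lie in a finite box for a separated reference.
[formal bookkeeping] -/
theorem fz_pairBox_finite {s R_N r_f dK dstar κ c_T cχ τ ϱ r₁ r₂ : ℝ} {P : PeriodicConfiguration 3} {C X : Set E3}
    (h1 : IsSeparatedRef s P) (hs : 0 < s) (x : E3) :
    Set.Finite {p : E3 × E3 | HeavyActive ϱχ D σ r_f dK dstar κ c_T cχ P C X τ ϱ r₁ r₂ p.1 p.2 ∧ dist x p.1 ≤ R_N} := by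
  refine ((h1.finite_inter_closedBall hs x R_N).prod (h1.finite_inter_closedBall hs x (R_N + r₂))).subset ?_
  rintro ⟨y', z'⟩ ⟨hH, hd⟩
  obtain ⟨hy', hz', -, hd2⟩ := hH.1.1
  refine Set.mk_mem_prod ⟨hy', ?_⟩ ⟨hz', ?_⟩
  · rw [Metric.mem_closedBall, dist_comm]; exact hd
  · rw [Metric.mem_closedBall]
    have := dist_triangle z' y' x
    rw [dist_comm z' y', dist_comm y' x] at this
    linarith

/-- ★★ **DOMINATION OF THE LOAD (PROVED)**: under (KC), `ballLoad(x) ≤ frozenLoad(x)` for a separated framed reference (the χ-free heavy pairs are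
clean non-plateau shell pairs: the bridge; the others are unchanged). -/
theorem ballLoad_le_frozenLoad {s R_N unit r_f dK dstar κ c_T cχ τ ϱ r₁ r₂ ρlo ρhi : ℝ} {P : PeriodicConfiguration 3} {C X : Set E3}
    (h1 : IsSeparatedRef s P) (hs : 0 < s) (hu : 0 ≤ unit) (hϱ : 0 < ϱ) (hϱχ : 0 < ϱχ) (hr₁ : 0 ≤ r₁) (hsmall : 2 * (r₁ + r₂) < ϱχ / 2)
    (hlo : 0 < ρlo) (hK : KinkCostTableQ ρlo ρhi ϱ τ unit) (hFr : IsFramedOct P r₁ r₂ ρlo ρhi) (x : E3) :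
    ballLoad ϱχ D σ R_N r_f dK dstar κ c_T cχ P C X τ ϱ r₁ r₂ x ≤ frozenLoad ϱχ D σ R_N unit r_f dK dstar κ c_T cχ P C X τ ϱ r₁ r₂ x := by
  unfold ballLoad frozenLoad
  set B := (fz_pairBox_finite (ϱχ := ϱχ) (D := D) (σ := σ) (R_N := R_N) (r_f := r_f) (dK := dK) (dstar := dstar) (κ := κ) (c_T := c_T)
    (cχ := cχ) (τ := τ) (ϱ := ϱ) (r₁ := r₁) (r₂ := r₂) (C := C) (X := X) h1 hs x).toFinset with hB
  have hsupp : ∀ g : E3 × E3 → ℝ, Function.support (fun p : E3 × E3 =>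
      if HeavyActive ϱχ D σ r_f dK dstar κ c_T cχ P C X τ ϱ r₁ r₂ p.1 p.2 ∧ dist x p.1 ≤ R_N then g p else 0) ⊆ ↑B := by
    intro g p hp
    rw [Function.mem_support] at hp
    rw [hB, Set.Finite.coe_toFinset, Set.mem_setOf_eq]
    by_contra hc
    exact hp (if_neg hc)
  refine fz_finsum_le B (hsupp fun p => (1 / 6) * frameVal (roofVal T75) τ (siteW ϱχ D σ X ϱ C) P r₁ p.1 p.2)
    (hsupp fun p => (1 / 6) * frozenCost ϱχ D σ unit P C X τ ϱ r₁ p.1 p.2) fun p _ => ?_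
  by_cases hc : HeavyActive ϱχ D σ r_f dK dstar κ c_T cχ P C X τ ϱ r₁ r₂ p.1 p.2 ∧ dist x p.1 ≤ R_N
  · rw [if_pos hc, if_pos hc]
    refine mul_le_mul_of_nonneg_left ?_ (by norm_num)
    unfold frozenCost
    by_cases hcf : OctChiFree ϱχ D P r₁ p.1 p.2
    · rw [if_pos hcf]
      obtain ⟨⟨hy, hz, hd1, hd2⟩, hclean, hplat, -, -⟩ := hc.1.1
      exact frameVal_le_capVal hu hϱ hϱχ hr₁ hsmall hlo hK hFr hy hz hd1 hd2 hclean hplat hcf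
    · rw [if_neg hcf]
  · rw [if_neg hc, if_neg hc]

/-- ★★ **DOMINATION OF THE MOMENT (PROVED)**: under (KC), `Ξ(y) ≤ Ξ_F(y)` (pools are non-negative). -/
theorem ballMoment_le_frozenMoment {s R_N unit r_f dK dstar κ c_T cχ τ ϱ r₁ r₂ ρlo ρhi : ℝ} {P : PeriodicConfiguration 3} {C X : Set E3}
    (h1 : IsSeparatedRef s P) (hs : 0 < s) (hu : 0 ≤ unit) (hϱ : 0 < ϱ) (hϱχ : 0 < ϱχ) (hr₁ : 0 ≤ r₁) (hsmall : 2 * (r₁ + r₂) < ϱχ / 2)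
    (hlo : 0 < ρlo) (hK : KinkCostTableQ ρlo ρhi ϱ τ unit) (hFr : IsFramedOct P r₁ r₂ ρlo ρhi) (y : E3) :
    ballMoment ϱχ D σ R_N r_f dK dstar κ c_T cχ P C X τ ϱ r₁ r₂ y ≤
      frozenMoment ϱχ D σ R_N unit r_f dK dstar κ c_T cχ P C X τ ϱ r₁ r₂ y := by
  unfold ballMoment frozenMoment
  set B := (h1.finite_inter_closedBall hs y R_N).toFinset with hB
  have hsupp : ∀ g : E3 → ℝ, Function.support (fun x : E3 => if x ∈ P.points ∧ dist x y ≤ R_N then g x else 0) ⊆ ↑B := by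
    intro g x hx
    rw [Function.mem_support] at hx
    rw [hB, Set.Finite.coe_toFinset]
    by_contra hc
    refine hx (if_neg fun hb => hc ⟨hb.1, ?_⟩)
    rw [Metric.mem_closedBall]
    exact hb.2
  refine fz_finsum_le B (hsupp fun x => pool ϱχ D σ r_f dK dstar κ c_T cχ P C X τ ϱ r₁ r₂ x *
      ballLoad ϱχ D σ R_N r_f dK dstar κ c_T cχ P C X τ ϱ r₁ r₂ x)
    (hsupp fun x => pool ϱχ D σ r_f dK dstar κ c_T cχ P C X τ ϱ r₁ r₂ x *
      frozenLoad ϱχ D σ R_N unit r_f dK dstar κ c_T cχ P C X τ ϱ r₁ r₂ x) fun x _ => ?_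
  by_cases hc : x ∈ P.points ∧ dist x y ≤ R_N
  · rw [if_pos hc, if_pos hc]
    exact mul_le_mul_of_nonneg_left (ballLoad_le_frozenLoad h1 hs hu hϱ hϱχ hr₁ hsmall hlo hK hFr x)
      (pool_nonneg r_f dK dstar κ c_T cχ P C X τ ϱ r₁ r₂ x)
  · rw [if_neg hc, if_neg hc]

/-- ★★★ **GLUE OF NODE 81 (PROVED)**: (KC) ∧ (M_F) ⟹ (M°)′ `BallMatchingQ'`, for any class, whenever `0 < s`, `0 ≤ unit`, `0 < ϱ`, `0 < ϱχ`,
`0 ≤ r₁`, `2(r₁ + r₂) < ϱχ/2`, `0 < ρlo`. -/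
theorem ballMatchingQ'_of_frozen {cls : Set E3 → Prop} {R_N r_f dK dstar κ c_T cχ unit s lam ℓ τ ϱ ϱχ r₁ r₂ ρlo ρhi : ℝ}
    (hs : 0 < s) (hu : 0 ≤ unit) (hϱ : 0 < ϱ) (hϱχ : 0 < ϱχ) (hr₁ : 0 ≤ r₁) (hsmall : 2 * (r₁ + r₂) < ϱχ / 2) (hlo : 0 < ρlo)
    (hK : KinkCostTableQ ρlo ρhi ϱ τ unit)
    (hM : FrozenMatchingQ' cls R_N r_f dK dstar κ c_T cχ unit s lam ℓ τ ϱ ϱχ r₁ r₂ ρlo ρhi) :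
    BallMatchingQ' cls R_N r_f dK dstar κ c_T cχ s lam ℓ τ ϱ ϱχ r₁ r₂ ρlo ρhi := by
  intro P C X m D σ h1 h2 hcl h3 h4 h6 h7 h11 hcv hFr y z hH hT
  obtain ⟨hPos, hMom⟩ := hM P C X m D σ h1 h2 hcl h3 h4 h6 h7 h11 hcv hFr y z hH hT
  exact ⟨hPos, (ballMoment_le_frozenMoment h1 hs hu hϱ hϱχ hr₁ hsmall hlo hK hFr y).trans hMom⟩

end Glue

end Summit.AtomisticToContinuum.Crystallization.Theorems.ChargedEnergyGapChartDial
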